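import Summits.QuantumFields.GaugeBoot.TruncatedRightRows
import Summits.QuantumFields.GaugeBoot.BootstrapReflections
import HarnessLib

/-!
# Link-reversing relabellings of a lattice bootstrap: left rows of the reversed links become right rows (gauge-boot, L1/L4 supplement)

HONEST FRAMING (cell `pub-gaugeboot`, page 1 of every file): the venture produces certified bounds
on lattice expectations at stated coupling, gauge group, dimension and torus size; NOT a mass gap,
NOT a continuum limit, NOT a string tension; NOT Yang–Mills-summit-bearing (barriers
`FixedCouplingUltralocality`, `PerturbativeInvisibility`). Structural; it certifies no number.

## Content (any lattice `ι`, any topological group `G`, any unitary representation `r`)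

`BootstrapSymmetryReduction` treats symmetries which RELABEL the links (`U ↦ U ∘ π`). An
orientation-reversing lattice symmetry (a reflection of the torus or of `ℤ^d`) maps some positively
oriented links onto NEGATIVELY oriented ones, read through the inverse. The mechanism, for any map
`θ : ι → ι` of the links and any set `rev` of links read REVERSED:

* `revRelabelCM θ rev : C(ι → G, ι → G)`, `(Θ U)_e = U_{θ e}⁻¹` if `rev e`, `U_{θ e}` otherwise
  (`revRelabelCM_of_forall_not`: no reversed link = the plain relabelling; `revRelabelCM_revRelabelCM`:
  an involution when `θ` is one and `rev` is `θ`-stable);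
* ★ `revRelabelCM_update_carried` / `_reversed` — at a carried link the left one-link shift at `θ e`
  is read as the left shift at `e`; at a REVERSED link the RIGHT shift (by the inverse) at `θ e` is;
* `reEntry_comp_revRelabelCM`, `imEntry_comp_revRelabelCM` (`ρ(U⁻¹) = ρ(U)ᴴ`: `Re ρ_{ab} ↦ Re ρ_{ba}`,
  `Im ρ_{ab} ↦ -Im ρ_{ba}` at a reversed link); `comp_revRelabelCM_entryGens` (generators ↦ `±`
  generators), ★ `comp_revRelabelCM_mem_polyAlgebra`, ★ `comp_revRelabelCM_mem_wordTruncation`;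
* ★★ `rows_comp_revRelabelCM` — THE LEVEL BOOKKEEPING: `Θ`-covariant local actions
  (`S_e (Θ U) = S_{θ e} U`), `φ` with the LEFT rows for the test functions of `W` and the RIGHT rows
  for those of a `Θ`-stable `V ⊆ W` ⇒ `φ ∘ Θ^*` has the left rows for `V` (carried link: the left
  row of `f ∘ Θ` at `θ e`; reversed link: the RIGHT row of `f ∘ Θ` at `θ e`);
* ★★ `IsBootstrapFeasible.comp_revRelabel_of_rightRows` (level-`W` feasible + right rows on `V` ⇒
  the reflected functional is level-`V` feasible); ★★ `IsSDFunctional.comp_revRelabel` (untruncated).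

Instances: the torus reflection `negReflectCM` (`BootstrapReflections`), the axis reflections
`configSiteReflect i` of `ℤ^d` (`ClassB`; sequel `BootstrapReflectionsZd`).

References: V. Kazakov, Z. Zheng, arXiv:2203.11360 §3.2–3.3 (loops modulo the hyperoctahedral
group); K. Gatermann, P. A. Parrilo, J. Pure Appl. Algebra 192 (2004) 95, Thm 3.3; M. Creutz,
Quarks, gluons and lattices (1983) Ch. 8 (link reversal carries the inverse). Folklore.
-/

noncomputable section

open Filter Topology NormedSpace
open Literature.MathematicalPhysics.QuantumFieldTheory (LatticeRep)

namespace Summit.QuantumFields.GaugeBoot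

/-! ## Link-reversing relabellings -/

section Defs

variable {ι : Type*} {G : Type*} [Group G] [TopologicalSpace G] [IsTopologicalGroup G]
  (θ : ι → ι) (rev : ι → Prop) [DecidablePred rev]

/-- **A link-reversing relabelling** of the configurations: the link `e` of the new configuration
reads the link `θ e` of the old one, INVERTED when `rev e` (the link `θ e` is traversed backwards).
[folklore] -/
def revRelabelCM : C(ι → G, ι → G) where
  toFun U e := if rev e then (U (θ e))⁻¹ else U (θ e)
  continuous_toFun := by
    refine continuous_pi fun e => ?_
    by_cases h : rev e
    · simp only [h, ↓reduceIte]
      exact (continuous_apply _).inv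
    · simp only [h, ↓reduceIte]
      exact continuous_apply _

/-- `revRelabelCM` evaluated. -/
@[simp] theorem revRelabelCM_apply (U : ι → G) (e : ι) :
    revRelabelCM (G := G) θ rev U e = if rev e then (U (θ e))⁻¹ else U (θ e) := rfl

/-- **No reversed link: the plain relabelling** of `BootstrapLatticeSymmetry`. -/
theorem revRelabelCM_of_forall_not (h : ∀ e, ¬ rev e) :
    revRelabelCM (G := G) θ rev = relabelCM (G := G) θ := by
  ext U e
  rw [revRelabelCM_apply, if_neg (h e), relabelCM_apply]

/-- **An involution** when `θ` is an involution and the reversed set is `θ`-stable. -/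
theorem revRelabelCM_revRelabelCM (hθ : Function.Involutive θ) (hrev : ∀ e, rev (θ e) ↔ rev e)
    (U : ι → G) : revRelabelCM (G := G) θ rev (revRelabelCM (G := G) θ rev U) = U := by
  funext e
  by_cases he : rev e
  · rw [revRelabelCM_apply, if_pos he, revRelabelCM_apply, if_pos ((hrev e).2 he), hθ e, inv_inv]
  · have hne : ¬ rev (θ e) := fun h => he ((hrev e).1 h)
    rw [revRelabelCM_apply, if_neg he, revRelabelCM_apply, if_neg hne, hθ e]

/-- The involution as an identity of continuous maps. -/
theorem revRelabelCM_comp_self (hθ : Function.Involutive θ) (hrev : ∀ e, rev (θ e) ↔ rev e) :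
    (revRelabelCM (G := G) θ rev).comp (revRelabelCM (G := G) θ rev) = ContinuousMap.id _ := by
  ext U e
  rw [ContinuousMap.comp_apply, revRelabelCM_revRelabelCM θ rev hθ hrev, ContinuousMap.id_apply]

/-- An observable composed twice with the involution is itself. -/
theorem comp_revRelabelCM_comp_revRelabelCM (hθ : Function.Involutive θ) (hrev : ∀ e, rev (θ e) ↔ rev e)
    (x : C(ι → G, ℝ)) :
    (x.comp (revRelabelCM (G := G) θ rev)).comp (revRelabelCM (G := G) θ rev) = x := by
  rw [ContinuousMap.comp_assoc, revRelabelCM_comp_self θ rev hθ hrev, ContinuousMap.comp_id]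

variable [DecidableEq ι]

/-- ★ **Carried links**: for a link `e` read forwards the map intertwines the left one-link shift at
`θ e` with the left shift at `e`: `Θ (U[θe ↦ g U_{θe}]) = (Θ U)[e ↦ g (Θ U)_e]` (`θ` injective).
[folklore] -/
theorem revRelabelCM_update_carried (hθ : Function.Injective θ) (U : ι → G) {e : ι} (he : ¬ rev e)
    (g : G) :
    revRelabelCM (G := G) θ rev (Function.update U (θ e) (g * U (θ e))) =
      Function.update (revRelabelCM (G := G) θ rev U) e (g * revRelabelCM (G := G) θ rev U e) := by
  funext e'
  by_cases h : e' = e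
  · subst h
    rw [Function.update_self, revRelabelCM_apply, revRelabelCM_apply, if_neg he, if_neg he,
      Function.update_self]
  · have hne : θ e' ≠ θ e := fun h' => h (hθ h')
    rw [Function.update_of_ne h, revRelabelCM_apply, revRelabelCM_apply, Function.update_of_ne hne]

/-- ★ **Reversed links**: for a link `e` read BACKWARDS the map intertwines the RIGHT shift by the
inverse at `θ e` with the left shift at `e`: `Θ (U[θe ↦ U_{θe} g⁻¹]) = (Θ U)[e ↦ g (Θ U)_e]`.
[folklore] -/
theorem revRelabelCM_update_reversed (hθ : Function.Injective θ) (U : ι → G) {e : ι} (he : rev e)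
    (g : G) :
    revRelabelCM (G := G) θ rev (Function.update U (θ e) (U (θ e) * g⁻¹)) =
      Function.update (revRelabelCM (G := G) θ rev U) e (g * revRelabelCM (G := G) θ rev U e) := by
  funext e'
  by_cases h : e' = e
  · subst h
    rw [Function.update_self, revRelabelCM_apply, revRelabelCM_apply, if_pos he, if_pos he,
      Function.update_self, mul_inv_rev, inv_inv]
  · have hne : θ e' ≠ θ e := fun h' => h (hθ h')
    rw [Function.update_of_ne h, revRelabelCM_apply, revRelabelCM_apply, Function.update_of_ne hne]

end Defs

/-! ## Polynomial observables and words under a link-reversing relabelling -/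

section Words

variable {ι : Type*} {G : Type*} [Group G] [TopologicalSpace G] [IsTopologicalGroup G]
  (r : LatticeRep G) (θ : ι → ι) (rev : ι → Prop) [DecidablePred rev]

/-- **A real-part generator composed with the map**: `Re ρ(U_e)_{ab} ∘ Θ = Re ρ(U_{θe})_{ba}` at a
reversed link (unitarity, `ρ(U⁻¹) = ρ(U)ᴴ`), `Re ρ(U_{θe})_{ab}` at a carried one. -/
theorem reEntry_comp_revRelabelCM (e : ι) (a b : Fin r.N) :
    (reEntry r e a b).comp (revRelabelCM (G := G) θ rev) =
      if rev e then reEntry r (θ e) b a else reEntry r (θ e) a b := by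
  ext U
  by_cases he : rev e
  · simp only [ContinuousMap.comp_apply, revRelabelCM_apply, reEntry_apply, he, ↓reduceIte]
    exact (rho_inv_apply_re_im r _ a b).1
  · simp only [ContinuousMap.comp_apply, revRelabelCM_apply, reEntry_apply, he, ↓reduceIte]

/-- **An imaginary-part generator composed with the map**: `Im ρ(U_e)_{ab} ∘ Θ = -Im ρ(U_{θe})_{ba}`
at a reversed link, `Im ρ(U_{θe})_{ab}` at a carried one. -/
theorem imEntry_comp_revRelabelCM (e : ι) (a b : Fin r.N) :
    (imEntry r e a b).comp (revRelabelCM (G := G) θ rev) =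
      if rev e then -imEntry r (θ e) b a else imEntry r (θ e) a b := by
  ext U
  by_cases he : rev e
  · simp only [ContinuousMap.comp_apply, revRelabelCM_apply, imEntry_apply, he, ↓reduceIte,
      ContinuousMap.neg_apply]
    exact (rho_inv_apply_re_im r _ a b).2
  · simp only [ContinuousMap.comp_apply, revRelabelCM_apply, imEntry_apply, he, ↓reduceIte]

/-- **Generators go to `±` generators.** -/
theorem comp_revRelabelCM_entryGens {x : C(ι → G, ℝ)} (hx : x ∈ entryGens (ι := ι) r) :
    ∃ y ∈ entryGens (ι := ι) r,
      x.comp (revRelabelCM (G := G) θ rev) = y ∨ x.comp (revRelabelCM (G := G) θ rev) = -y := by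
  rcases hx with ⟨⟨e, a, b⟩, rfl⟩ | ⟨⟨e, a, b⟩, rfl⟩
  · by_cases he : rev e
    · refine ⟨reEntry r (θ e) b a, Or.inl ⟨(θ e, b, a), rfl⟩, Or.inl ?_⟩
      have h := reEntry_comp_revRelabelCM r θ rev e a b
      rw [if_pos he] at h
      exact h
    · refine ⟨reEntry r (θ e) a b, Or.inl ⟨(θ e, a, b), rfl⟩, Or.inl ?_⟩
      have h := reEntry_comp_revRelabelCM r θ rev e a b
      rw [if_neg he] at h
      exact h
  · by_cases he : rev e
    · refine ⟨imEntry r (θ e) b a, Or.inr ⟨(θ e, b, a), rfl⟩, Or.inr ?_⟩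
      have h := imEntry_comp_revRelabelCM r θ rev e a b
      rw [if_pos he] at h
      exact h
    · refine ⟨imEntry r (θ e) a b, Or.inr ⟨(θ e, a, b), rfl⟩, Or.inl ?_⟩
      have h := imEntry_comp_revRelabelCM r θ rev e a b
      rw [if_neg he] at h
      exact h

/-- ★ **The polynomial observables are stable under a link-reversing relabelling.** [folklore] -/
theorem comp_revRelabelCM_mem_polyAlgebra {f : C(ι → G, ℝ)} (hf : f ∈ polyAlgebra (ι := ι) r) :
    f.comp (revRelabelCM (G := G) θ rev) ∈ polyAlgebra (ι := ι) r := by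
  have h : polyAlgebra (ι := ι) r ≤ (polyAlgebra (ι := ι) r).comap
      (ContinuousMap.compRightAlgHom ℝ ℝ (revRelabelCM (G := G) θ rev)) := by
    refine Algebra.adjoin_le fun x hx => ?_
    obtain ⟨y, hy, hxy⟩ := comp_revRelabelCM_entryGens r θ rev hx
    change x.comp (revRelabelCM (G := G) θ rev) ∈ polyAlgebra (ι := ι) r
    rcases hxy with h | h <;> rw [h]
    · exact Algebra.subset_adjoin hy
    · exact Subalgebra.neg_mem _ (Algebra.subset_adjoin hy)
  exact h hf

/-- **A word of length `≤ n` composed with the map is `±` a word of length `≤ n`.** -/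
theorem comp_revRelabelCM_wordsUpTo {n : ℕ} {w : C(ι → G, ℝ)} (hw : w ∈ wordsUpTo (ι := ι) r n) :
    ∃ w' ∈ wordsUpTo (ι := ι) r n,
      w.comp (revRelabelCM (G := G) θ rev) = w' ∨ w.comp (revRelabelCM (G := G) θ rev) = -w' := by
  obtain ⟨l, hl, hlen, rfl⟩ := hw
  induction l generalizing n with
  | nil => exact ⟨1, ⟨[], by simp, by simp, by simp⟩, Or.inl (by ext U; rfl)⟩
  | cons x l ih =>
    obtain ⟨y, hy, hxy⟩ := comp_revRelabelCM_entryGens r θ rev (hl x List.mem_cons_self)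
    obtain ⟨w', hw', hlw'⟩ := ih (n := l.length) (fun z hz => hl z (List.mem_cons_of_mem x hz)) le_rfl
    obtain ⟨l', hl', hl'len, rfl⟩ := hw'
    have hmem : (y :: l').prod ∈ wordsUpTo (ι := ι) r n :=
      ⟨y :: l', fun z hz => by
        rcases List.mem_cons.1 hz with rfl | hz
        · exact hy
        · exact hl' z hz, by simp at hlen ⊢; omega, rfl⟩
    refine ⟨(y :: l').prod, hmem, ?_⟩
    have hprod : ((x :: l).prod).comp (revRelabelCM (G := G) θ rev) =
        x.comp (revRelabelCM (G := G) θ rev) * (l.prod).comp (revRelabelCM (G := G) θ rev) := by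
      rw [List.prod_cons]; rfl
    rw [hprod, List.prod_cons]
    rcases hxy with h1 | h1 <;> rcases hlw' with h2 | h2 <;> rw [h1, h2]
    · exact Or.inl rfl
    · exact Or.inr (by rw [mul_neg])
    · exact Or.inr (by rw [neg_mul])
    · exact Or.inl (by rw [neg_mul_neg])

/-- ★ **Every word truncation is stable under a link-reversing relabelling.** [folklore] -/
theorem comp_revRelabelCM_mem_wordTruncation {n : ℕ} {v : C(ι → G, ℝ)}
    (hv : v ∈ wordTruncation (ι := ι) r n) :
    v.comp (revRelabelCM (G := G) θ rev) ∈ wordTruncation (ι := ι) r n := by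
  have h : Submodule.span ℝ (wordsUpTo (ι := ι) r n) ≤
      (Submodule.span ℝ (wordsUpTo (ι := ι) r n)).comap
        (ContinuousMap.compRightAlgHom ℝ ℝ (revRelabelCM (G := G) θ rev)).toLinearMap := by
    refine Submodule.span_le.2 fun w hw => ?_
    obtain ⟨w', hw', h⟩ := comp_revRelabelCM_wordsUpTo r θ rev hw
    change w.comp (revRelabelCM (G := G) θ rev) ∈ Submodule.span ℝ (wordsUpTo (ι := ι) r n)
    rcases h with h | h <;> rw [h]
    · exact Submodule.subset_span hw'
    · exact Submodule.neg_mem _ (Submodule.subset_span hw')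
  exact h hv

end Words

/-! ## The loop equations under a link-reversing relabelling -/

section Rows

variable {ι : Type*} [DecidableEq ι] {G : Type*} [Group G] [TopologicalSpace G] [IsTopologicalGroup G]
  (r : LatticeRep G) (θ : ι → ι) (rev : ι → Prop) [DecidablePred rev]
  {K : Type*} {k : K → ℝ → G} {S : ι → (ι → G) → ℝ} {β : ℝ}

/-- ★★ **The level bookkeeping.** `θ` injective, `Θ`-covariant local actions
(`S_e (Θ U) = S_{θ e} U`), one-parameter groups `k_a`. If `φ` satisfies the LEFT rows for every
test function of `W` and the RIGHT rows for every test function of `V ⊆ W`, and `V` is `Θ`-stable,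
then `φ ∘ Θ^*` satisfies the left rows for every test function of `V`: the row of `f` at a carried
link `e` is the left row of `f ∘ Θ` at `θ e`; at a reversed link it is the RIGHT row of `f ∘ Θ` at
`θ e` (whose right derivatives are minus the reflected left derivatives). [folklore] -/
theorem rows_comp_revRelabelCM (hθ : Function.Injective θ)
    (hS : ∀ e U, S e (revRelabelCM (G := G) θ rev U) = S (θ e) U)
    (hk : ∀ a s t, k a (s + t) = k a s * k a t) {V W : Set C(ι → G, ℝ)} (hVW : V ⊆ W)
    (hVΘ : ∀ v ∈ V, v.comp (revRelabelCM (G := G) θ rev) ∈ V)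
    {φ : C(ι → G, ℝ) →ₗ[ℝ] ℝ}
    (hrows : ∀ (i : ι) (a : K), ∃ S' ∈ polyAlgebra (ι := ι) r,
      (∀ U, HasDerivAt (fun t => S i (Function.update U i (k a t * U i))) (S' U) 0) ∧
        ∀ f ∈ W, ∀ f' ∈ polyAlgebra (ι := ι) r,
          (∀ U, HasDerivAt (fun t => f (Function.update U i (k a t * U i))) (f' U) 0) →
            φ f' = β * φ (f * S'))
    (hR : IsRightRowsOn r k S β V φ) :
    ∀ (i : ι) (a : K), ∃ S' ∈ polyAlgebra (ι := ι) r,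
      (∀ U, HasDerivAt (fun t => S i (Function.update U i (k a t * U i))) (S' U) 0) ∧
        ∀ f ∈ V, ∀ f' ∈ polyAlgebra (ι := ι) r,
          (∀ U, HasDerivAt (fun t => f (Function.update U i (k a t * U i))) (f' U) 0) →
            (φ ∘ₗ (ContinuousMap.compRightAlgHom ℝ ℝ (revRelabelCM (G := G) θ rev)).toLinearMap) f' =
              β * (φ ∘ₗ (ContinuousMap.compRightAlgHom ℝ ℝ
                (revRelabelCM (G := G) θ rev)).toLinearMap) (f * S') := by
  intro i a
  obtain ⟨S', hS'm, hS', -⟩ := hrows i a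
  refine ⟨S', hS'm, hS', fun f hf f' hf'm hf' => ?_⟩
  change φ (f'.comp (revRelabelCM (G := G) θ rev)) =
    β * φ ((f * S').comp (revRelabelCM (G := G) θ rev))
  by_cases hi : rev i
  · -- reversed link: the right row at `θ i` for the test function `f ∘ Θ ∈ V`
    obtain ⟨SR, hSRm, hSR, hrowR⟩ := hR (θ i) a
    have hflip : ∀ (h : (ι → G) → ℝ) (U : ι → G),
        (fun t => h (revRelabelCM (G := G) θ rev
          (Function.update U (θ i) (U (θ i) * k a t)))) =
          fun t => h (Function.update (revRelabelCM (G := G) θ rev U) i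
            (k a (-t) * revRelabelCM (G := G) θ rev U i)) := fun h U => by
      funext t
      rw [← revRelabelCM_update_reversed θ rev hθ U hi, ← oneParam_neg (hk a), neg_neg]
    -- the right derivative of `f ∘ Θ` at `θ i` is `-(f' ∘ Θ)`
    have hF' : ∀ U, HasDerivAt (fun t => (f.comp (revRelabelCM (G := G) θ rev))
        (Function.update U (θ i) (U (θ i) * k a t)))
        ((-(f'.comp (revRelabelCM (G := G) θ rev))) U) 0 := fun U => by
      simp only [ContinuousMap.comp_apply, ContinuousMap.neg_apply]
      rw [hflip]
      exact hasDerivAt_comp_neg_zero (hf' (revRelabelCM (G := G) θ rev U))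
    -- the right derivative of the action at `θ i` is `-(S' ∘ Θ)`
    have hSR' : ∀ U, SR U = -S' (revRelabelCM (G := G) θ rev U) := fun U => by
      have h3 : HasDerivAt (fun t => S (θ i) (Function.update U (θ i) (U (θ i) * k a t)))
          (-S' (revRelabelCM (G := G) θ rev U)) 0 := by
        have hfun : (fun t => S (θ i) (Function.update U (θ i) (U (θ i) * k a t))) =
            fun t => S i (revRelabelCM (G := G) θ rev
              (Function.update U (θ i) (U (θ i) * k a t))) := by
          funext t; rw [hS]
        rw [hfun, hflip]
        exact hasDerivAt_comp_neg_zero (hS' (revRelabelCM (G := G) θ rev U))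
      exact (hSR U).unique h3
    have hrow := hrowR (f.comp (revRelabelCM (G := G) θ rev)) (hVΘ f hf)
      (-(f'.comp (revRelabelCM (G := G) θ rev)))
      (Subalgebra.neg_mem _ (comp_revRelabelCM_mem_polyAlgebra r θ rev hf'm)) hF'
    have hprod : f.comp (revRelabelCM (G := G) θ rev) * SR =
        -((f * S').comp (revRelabelCM (G := G) θ rev)) := by
      ext U
      simp [hSR']
    rw [map_neg, hprod, map_neg] at hrow
    linarith
  · -- carried link: the left row at `θ i` for the test function `f ∘ Θ ∈ V ⊆ W`
    obtain ⟨S₂, hS₂m, hS₂, hrow₂⟩ := hrows (θ i) a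
    have hflip : ∀ (h : (ι → G) → ℝ) (U : ι → G),
        (fun t => h (revRelabelCM (G := G) θ rev
          (Function.update U (θ i) (k a t * U (θ i))))) =
          fun t => h (Function.update (revRelabelCM (G := G) θ rev U) i
            (k a t * revRelabelCM (G := G) θ rev U i)) := fun h U => by
      funext t
      rw [revRelabelCM_update_carried θ rev hθ U hi]
    have hF' : ∀ U, HasDerivAt (fun t => (f.comp (revRelabelCM (G := G) θ rev))
        (Function.update U (θ i) (k a t * U (θ i))))
        ((f'.comp (revRelabelCM (G := G) θ rev)) U) 0 := fun U => by
      simp only [ContinuousMap.comp_apply]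
      rw [hflip]
      exact hf' (revRelabelCM (G := G) θ rev U)
    have hS₂' : ∀ U, S₂ U = S' (revRelabelCM (G := G) θ rev U) := fun U => by
      have h3 : HasDerivAt (fun t => S (θ i) (Function.update U (θ i) (k a t * U (θ i))))
          (S' (revRelabelCM (G := G) θ rev U)) 0 := by
        have hfun : (fun t => S (θ i) (Function.update U (θ i) (k a t * U (θ i)))) =
            fun t => S i (revRelabelCM (G := G) θ rev
              (Function.update U (θ i) (k a t * U (θ i)))) := by
          funext t; rw [hS]
        rw [hfun, hflip]
        exact hS' (revRelabelCM (G := G) θ rev U)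
      exact (hS₂ U).unique h3
    have hrow := hrow₂ (f.comp (revRelabelCM (G := G) θ rev)) (hVW (hVΘ f hf))
      (f'.comp (revRelabelCM (G := G) θ rev)) (comp_revRelabelCM_mem_polyAlgebra r θ rev hf'm) hF'
    have hprod : f.comp (revRelabelCM (G := G) θ rev) * S₂ =
        (f * S').comp (revRelabelCM (G := G) θ rev) := by
      ext U
      simp [hS₂']
    rwa [hprod] at hrow

/-- ★★ **Reflecting a truncated solution**: `θ` injective, `Θ`-covariant local actions. If `φ` is
level-`W` feasible, satisfies the RIGHT rows for the test functions of `V ⊆ W`, and `V` is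
`Θ`-stable, then `φ ∘ Θ^*` is level-`V` feasible (normalisation and positivity are read through
`Θ`; the rows by `rows_comp_revRelabelCM`). [folklore] -/
theorem IsBootstrapFeasible.comp_revRelabel_of_rightRows (hθ : Function.Injective θ)
    (hS : ∀ e U, S e (revRelabelCM (G := G) θ rev U) = S (θ e) U)
    (hk : ∀ a s t, k a (s + t) = k a s * k a t) {V W : Set C(ι → G, ℝ)} (hVW : V ⊆ W)
    (hVΘ : ∀ v ∈ V, v.comp (revRelabelCM (G := G) θ rev) ∈ V)
    {φ : C(ι → G, ℝ) →ₗ[ℝ] ℝ} (hφ : IsBootstrapFeasible r k S β W φ)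
    (hφR : IsRightRowsOn r k S β V φ) :
    IsBootstrapFeasible r k S β V
      (φ ∘ₗ (ContinuousMap.compRightAlgHom ℝ ℝ (revRelabelCM (G := G) θ rev)).toLinearMap) := by
  refine ⟨?_, fun v hv => ?_, rows_comp_revRelabelCM r θ rev hθ hS hk hVW hVΘ hφ.2.2 hφR⟩
  · change φ ((1 : C(ι → G, ℝ)).comp (revRelabelCM (G := G) θ rev)) = 1
    exact hφ.1
  · change 0 ≤ φ ((v * v).comp (revRelabelCM (G := G) θ rev))
    exact hφ.2.1 _ (hVW (hVΘ v hv))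

omit [IsTopologicalGroup G] in
/-- The right loop equations of `RightShiftRows` are the right rows on all polynomial test
functions. -/
theorem isRightRowsOn_polyAlgebra_iff {φ : C(ι → G, ℝ) →ₗ[ℝ] ℝ} :
    IsRightRowsOn r k S β (polyAlgebra (ι := ι) r : Set C(ι → G, ℝ)) φ ↔
      IsRightSDFunctional r k S β φ :=
  Iff.rfl

/-- ★★ **Untruncated: reflecting a Schwinger–Dyson functional which also satisfies the right loop
equations gives a Schwinger–Dyson functional** (`θ` injective, `Θ`-covariant polynomial local
actions). [folklore] -/
theorem IsSDFunctional.comp_revRelabel (hθ : Function.Injective θ)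
    (hS : ∀ e U, S e (revRelabelCM (G := G) θ rev U) = S (θ e) U)
    (hk : ∀ a s t, k a (s + t) = k a s * k a t)
    {φ : C(ι → G, ℝ) →ₗ[ℝ] ℝ} (hφ : IsSDFunctional r k S β φ) (hφR : IsRightSDFunctional r k S β φ) :
    IsSDFunctional r k S β
      (φ ∘ₗ (ContinuousMap.compRightAlgHom ℝ ℝ (revRelabelCM (G := G) θ rev)).toLinearMap) :=
  rows_comp_revRelabelCM r θ rev hθ hS hk (V := (polyAlgebra (ι := ι) r : Set C(ι → G, ℝ)))
    subset_rfl (fun _ hv => comp_revRelabelCM_mem_polyAlgebra r θ rev hv) hφ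
    ((isRightRowsOn_polyAlgebra_iff r).2 hφR)

end Rows

end Summit.QuantumFields.GaugeBoot

end
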